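import Literature.NumberTheory.Rogawski1990.FinExplicitTransferFactorGHRegular   -- ★ `finKappaAt_of_not_subsingleton`, `finEigenlineProjector_ne_zero_of_isUnit`, `eval_finCharpolyTwo_finGammaTwo`
import Literature.NumberTheory.Automorphic.UnitaryGroupSplitPlace               -- ★ `PlacesOver.eq_or_eq_galInv`, `PlacesOver.galInv_ne` (split places: two places `w ≠ c⁻¹w`)
import Literature.NumberTheory.Automorphic.AdelicVectorHeightGalois             -- ★ `norm_galAdicCompletionMap` (`‖σ y‖_{σ w} = ‖y‖_w`)
import Literature.NumberTheory.Automorphic.UnitaryGroupLocalCongr               -- ★ `adelicForm_map_adeleToLocal`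
import HarnessLib

/-!
# Rogawski's explicit factor at a place SPLIT in `L`: `Δ‴_v = τ_v · D_{G∕H,v}` (`κ_v = +1`), and `D_{G∕H,v}(γ_H) = ‖χ_g(u)‖_w · ‖det g‖_w^{−1∕2} · ‖u‖_w^{−1}`
# `= ‖det(1 − K)‖_w · ‖det K‖_w^{−1∕2}`, `K = u⁻¹g = Ad(diag(g,u))|_𝔫`, in the `GL₂(L_w) × L_wˣ` coordinates of `γ_H` (Rogawski (1990) §4.9 p. 55, L. 4.13.1 p. 70)

Topic `NumberTheory/Rogawski1990`; namespace `Literature.NumberTheory.Rogawski1990`.  THEOREMS ONLY (no definition, no named fact, no instance, no notation,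
no `sorry`; net debt 0).  Cell `pub/hodgecm-mathlib`, F0∕P3a, topic T6 (#88 side; road letter «D-S2» of `SIZING-S1prime` §2 row 3b ∕ §5, the explicit-factor side of
the floor-1 letter (κ-loc-split); second hand on F0P3a-p04's D-S1 road, LEAD T6-56∕T6-57 «=», p04 (g11) 22:03:09Z normal form).  Mathlib-only footing; count-neutral.

THE MATHEMATICS.  `v` a finite place of `L⁺` SPLIT in `L`: two places `w ≠ w̄ = c⁻¹w` above `v` (★ `PlacesOver.eq_or_eq_galInv`, `PlacesOver.galInv_ne`), `E_v =
L_w × L_{w̄}`, `σ = galAdicCompletionMap c : L_{w̄} ≃ L_w` an isometry (★ `norm_galAdicCompletionMap`), `(c ⊗ 1)(x)_w = σ(x_{w̄})` (★ `conjLocal_apply`).  For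
`γ_H = (g, u) ∈ H_v = U(Φ₂) × U(Φ₁)` write `g_w ∈ GL₂(L_w)`, `u_w ∈ L_wˣ` for the `w`-components (= ★ `localPiSplitEquiv γ_H`, the `w`-projection).  Unitarity
`(c⊗1)(g)ᵀ Φ₂ g = Φ₂` read at the component `w` gives `σ(g_{w̄})ᵀ Φ₂ g_w = Φ₂` and `σ(u_{w̄}) u_w = 1` (§2), so `σ(g_{w̄})` is `Φ₂`-conjugate to `g_w⁻ᵀ`,
`charpoly σ(g_{w̄}) = charpoly g_w⁻¹`, and with the `2 × 2` identity `χ_{g⁻¹}(u⁻¹) = χ_g(u)·(det g)⁻¹·u⁻²` (§1): **`σ(χ_g(u)_{w̄}) = χ_{g_w}(u_w)·(det g_w)⁻¹·u_w⁻²`**,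
hence `‖χ_g(u)_{w̄}‖_{w̄} = ‖χ_{g_w}(u_w)‖_w ‖det g_w‖_w⁻¹ ‖u_w‖_w⁻²` and (★ `finWeylRatio = (Π_{w′∣v} ‖χ_g(u)_{w′}‖)^{1∕2}`, the product over `{w, w̄}`)
**`D_{G∕H,v}(γ_H) = ‖χ_{g_w}(u_w)‖_w · ‖det g_w‖_w^{−1∕2} · ‖u_w‖_w^{−1}`** — print's `|D_{G∕H}(γ)| = |Π_{α∉H}(1 − α(γ))|^{1∕2}` on `GL₃ ⊃ GL₂ × GL₁`, eigenvalue-free.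
BOX FORM (F0P3a-p04's descent normal form, ★ `GLnTwoBlockUnipotentConjugation`∕`…ChangeOfVariables`: `p = diag(g, u)`, `K_p = Ad(p)|_𝔫 = g ⊗ u⁻¹` on the
root box `𝔫 ≅ L_w²`, `δ_P(p) = ‖det K_p‖`, `|D_{G∕M}(p)| = ‖det(1 − K_p)‖²·‖det K_p‖⁻¹`): with `K := u_w⁻¹·g_w` (the matrix of `X ↦ g X u⁻¹` on `L_w²`),
**`D_{G∕H,v}(γ_H) = ‖det(1 − K)‖_w · ‖det K‖_w^{−1∕2}`** and `D² · ‖det g_w‖ · ‖u_w‖² = ‖χ_{g_w}(u_w)‖²`.  Finally at a split `v` every matching pair has `κ_v = +1`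
(★ `finKappaAt_of_not_subsingleton`), so `Δ‴_v(γ_H, γ′) = τ_v(γ_H)·D_{G∕H,v}(γ_H)` for every `γ′` matching `γ_H` with `χ_g(u)` a unit — a function of `γ_H`
alone; `τ_v`'s Hecke values factor as `μ_w · μ_{w̄}` (★ `semilocalComponent_eq_prod`).

* §1 `eval_charpoly_inv_two` (`2×2`: `χ_{M⁻¹}(t⁻¹) = χ_M(t)·(det M)⁻¹·t⁻²`), `det_one_sub_inv_smul_two`, `det_inv_smul_two` (box-form algebra).
* §2 (split bookkeeping on `H_v`) `eval_finCharpolyTwo_apply` (componentwise `χ_g(u)`), `univ_eq_pair_of_split`, `conjLocal_apply_galInv_eq_galAdicCompletionMap`,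
  `transpose_map_galInv_mul_form_mul_eq` (unitarity at `w`), `galAdicCompletionMap_finGammaTwo_galInv` (`σ(u_{w̄}) = u_w⁻¹`), `charpoly_map_galInv_eq_charpoly_inv`, **`galAdicCompletionMap_eval_finCharpolyTwo_galInv`**,
  **`norm_eval_finCharpolyTwo_galInv`**.
* §3 **`finWeylRatio_eq_of_split`**, **`finWeylRatio_eq_box_of_split`**, `finWeylRatio_sq_mul_of_split`.
* §4 `not_subsingleton_placesOver_of_split`, **`finExplicitDelta_eq_tau_mul_weyl_of_split`**, `finHeckeValue_eq_prod_pair_of_split`.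

HONEST LABEL: HC_CM is proved only modulo the printed citations (named inputs remaining 2) until rung 0 closes; this file proves none of them — it is the
explicit-factor side of the (κ-loc-split) letter of `S1′`; the orbital-integral side (parabolic descent, the `GL₂` germ) is F0P3a-p04's D-S1∕D-S3 road.

## References
* [Rogawski1990] J. D. Rogawski, *Automorphic Representations of Unitary Groups in Three Variables*, Ann. of Math. Stud. 123 (1990): §4.9 p. 55 (`D_{G∕H} = D_G∕D_H`,
  `Δ_{G∕H} = τ D_{G∕H}`; split case), Lemma 4.13.1 p. 70 (the `(G,H)`-regular split descent), §14.6 p. 242 (`κ = +1` at split places).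
* [Mok2014] C. P. Mok, *Endoscopic classification of representations of quasi-split unitary groups*, Mem. AMS 235 (2015), §1 p. 5 (`U(N)(F_v) ≅ GL_N(F_v)` at split `v`).
* [CasselsFrohlichANT1967] J. W. S. Cassels, A. Fröhlich (eds.), *Algebraic Number Theory* (1967), Ch. VII Prop. 1.2 (ii) (places above `v`), Ch. II §§10–11.
-/

set_option autoImplicit false

noncomputable section

open NumberField IsDedekindDomain Matrix Polynomial
open scoped MatrixGroups

namespace Literature.NumberTheory.Rogawski1990

open Literature.NumberTheory.Automorphic
open Literature.NumberTheory.GaloisRepresentations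

/-! ## §1 `2 × 2` algebra -/

section TwoByTwo

variable {K : Type*} [Field K]

/-- **`χ_{M⁻¹}(t⁻¹) = χ_M(t) · (det M)⁻¹ · t⁻²`** for an invertible `2×2` matrix and `t ≠ 0` (`M⁻¹ = (det M)⁻¹ adj M`, `tr adj M = tr M`, `charpoly_fin_two`).
[cite: Rogawski1990, §4.9 p. 55] -/
theorem eval_charpoly_inv_two (M : Matrix (Fin 2) (Fin 2) K) (hM : IsUnit M.det) {t : K} (ht : t ≠ 0) :
    (M⁻¹).charpoly.eval t⁻¹ = M.charpoly.eval t * (M.det)⁻¹ * (t ^ 2)⁻¹ := by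
  have hdet : M.det ≠ 0 := hM.ne_zero
  have hd1 : M 0 0 * M 1 1 - M 0 1 * M 1 0 ≠ 0 := by rwa [Matrix.det_fin_two] at hdet
  have hd2 : M 1 1 * M 0 0 - M 0 1 * M 1 0 ≠ 0 := by rwa [mul_comm (M 1 1)]
  have hinv : M⁻¹ = (M.det)⁻¹ • M.adjugate := by
    rw [Matrix.inv_def, Ring.inverse_eq_inv']
  rw [hinv, Matrix.adjugate_fin_two, Matrix.charpoly_fin_two, Matrix.charpoly_fin_two]
  simp only [eval_add, eval_sub, eval_mul, eval_pow, eval_X, eval_C, Matrix.trace_fin_two, Matrix.det_fin_two, Matrix.smul_apply,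
    Matrix.of_apply, Matrix.cons_val', Matrix.cons_val_zero, Matrix.cons_val_one, Matrix.empty_val', Matrix.cons_val_fin_one, smul_eq_mul]
  field_simp
  ring

/-- **`det(1 − t⁻¹ M) = t⁻² · χ_M(t)`** (`2×2`, `t ≠ 0`). [cite: Rogawski1990, Lemma 4.13.1 p. 70] -/
theorem det_one_sub_inv_smul_two (M : Matrix (Fin 2) (Fin 2) K) {t : K} (ht : t ≠ 0) :
    (1 - t⁻¹ • M).det = (t ^ 2)⁻¹ * M.charpoly.eval t := by
  rw [Matrix.charpoly_fin_two, Matrix.det_fin_two]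
  simp only [eval_add, eval_sub, eval_mul, eval_pow, eval_X, eval_C, Matrix.trace_fin_two, Matrix.det_fin_two, Matrix.sub_apply,
    Matrix.smul_apply, Matrix.one_apply_eq, Matrix.one_apply_ne (by decide : (0 : Fin 2) ≠ 1), Matrix.one_apply_ne (by decide : (1 : Fin 2) ≠ 0),
    smul_eq_mul]
  field_simp
  ring

/-- `det(t⁻¹ M) = t⁻² det M` (`2×2`). [folklore] -/
private theorem det_inv_smul_two (M : Matrix (Fin 2) (Fin 2) K) (t : K) : (t⁻¹ • M).det = (t ^ 2)⁻¹ * M.det := by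
  rw [Matrix.det_smul, Fintype.card_fin, inv_pow]

end TwoByTwo

/-! ## §2 Split bookkeeping on `H_v`: componentwise `χ_g(u)`; unitarity read at the place `w` -/

section Split

variable (L : Type) [Field L] [NumberField L] [IsCMField L] (v : HeightOneSpectrum (𝓞 ↥(maximalRealSubfield L)))
  (a : (UnitaryGroup.cmDatum L 2 (Matrix.of fun i j : Fin 2 => if i.val + j.val + 1 = 2 then (1 : L) else 0)).Local v ×
      (UnitaryGroup.cmDatum L 1 (Matrix.of fun i j : Fin 1 => if i.val + j.val + 1 = 1 then (1 : L) else 0)).Local v)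

/-- **`χ_g(u)` componentwise**: `(χ_g(u))_{w′} = χ_{g_{w′}}(u_{w′})` for the `w′`-components `g_{w′} = g.map (· w′)`, `u_{w′}` (charpoly commutes with the ring
homomorphism `E_v → L_{w′}`). [cite: CasselsFrohlichANT1967, Ch. II §10–§11] -/
theorem eval_finCharpolyTwo_apply (w' : UnitaryGroup.PlacesOver L v) :
    ((finCharpolyTwo L v a).eval (finGammaTwo L v a)) w' =
      (((a.1.val.val : Matrix (Fin 2) (Fin 2) (UnitaryGroup.LocalRing L v)).map (fun x => x w')).charpoly).eval ((finGammaTwo L v a) w') := by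
  unfold finCharpolyTwo
  change Pi.evalRingHom (fun w : UnitaryGroup.PlacesOver L v => w.1.adicCompletion L) w'
      (((a.1.val.val : Matrix (Fin 2) (Fin 2) (UnitaryGroup.LocalRing L v)).charpoly).eval (finGammaTwo L v a)) = _
  rw [← Polynomial.eval₂_at_apply, ← Polynomial.eval_map, ← Matrix.charpoly_map]
  rfl

variable (w : UnitaryGroup.PlacesOver L v)

open scoped Classical in
/-- At a split `v` the places above `v` are exactly `w` and `w̄ = c⁻¹ w` (classically, as a `Finset`). [cite: CasselsFrohlichANT1967, Ch. VII Prop. 1.2 (ii)] -/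
theorem univ_eq_pair_of_split :
    (Finset.univ : Finset (UnitaryGroup.PlacesOver L v)) = {w, UnitaryGroup.PlacesOver.galInv (IsCMField.complexConj L) w} := by
  haveI : Algebra.IsQuadraticExtension ↥(maximalRealSubfield L) L := IsCMField.isQuadraticExtension L
  ext w'
  simp only [Finset.mem_univ, Finset.mem_insert, Finset.mem_singleton, true_iff]
  exact UnitaryGroup.PlacesOver.eq_or_eq_galInv (IsCMField.complexConj L) (IsCMField.complexConj_ne_one L) w w'

/-- The `w`-component of `(c ⊗ 1) x` is `σ(x_{w̄})` with `σ : L_{w̄} → L_w` the Galois transport (★ `conjLocal_apply`). [cite: CasselsFrohlichANT1967, Ch. VII §1.1] -/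
theorem conjLocal_apply_galInv_eq_galAdicCompletionMap (x : UnitaryGroup.LocalRing L v) :
    UnitaryGroup.conjLocal L (IsCMField.complexConj L) v x w =
      galAdicCompletionMap (L := L) (IsCMField.complexConj L)
        (smul_inv_smul (IsCMField.complexConj L) w.1) (x (UnitaryGroup.PlacesOver.galInv (IsCMField.complexConj L) w)) :=
  rfl

/-- **Unitarity of `g` read at the place `w`**: `σ(g_{w̄})ᵀ · Φ₂ · g_w = Φ₂` over `L_w`, `Φ₂ = antidiag(1,1)`. [cite: Rogawski1990, §4.9 p. 54] -/
theorem transpose_map_galInv_mul_form_mul_eq :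
    (((a.1.val.val : Matrix (Fin 2) (Fin 2) (UnitaryGroup.LocalRing L v)).map
          (fun x => x (UnitaryGroup.PlacesOver.galInv (IsCMField.complexConj L) w))).map
          (galAdicCompletionMap (L := L) (IsCMField.complexConj L) (smul_inv_smul (IsCMField.complexConj L) w.1)))ᵀ *
        (Matrix.of fun i j : Fin 2 => if i.val + j.val + 1 = 2 then (1 : w.1.adicCompletion L) else 0) *
        (a.1.val.val : Matrix (Fin 2) (Fin 2) (UnitaryGroup.LocalRing L v)).map (fun x => x w) =
      Matrix.of fun i j : Fin 2 => if i.val + j.val + 1 = 2 then (1 : w.1.adicCompletion L) else 0 := by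
  have hU := mem_unitaryGroupOfForm_iff.mp a.1.2
  -- push the identity over `E_v` to the component `w`
  have hUw := congrArg (fun M : Matrix (Fin 2) (Fin 2) (UnitaryGroup.LocalRing L v) =>
    M.map (Pi.evalRingHom (fun w' : UnitaryGroup.PlacesOver L v => w'.1.adicCompletion L) w)) hU
  simp only [Matrix.map_mul, Matrix.transpose_map, Matrix.map_map] at hUw
  have h1 : (a.1.val.val : Matrix (Fin 2) (Fin 2) (UnitaryGroup.LocalRing L v)).map
      (⇑(Pi.evalRingHom (fun w' : UnitaryGroup.PlacesOver L v => w'.1.adicCompletion L) w) ∘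
        ⇑(UnitaryGroup.conjLocal L (IsCMField.complexConj L) v)) =
      (((a.1.val.val : Matrix (Fin 2) (Fin 2) (UnitaryGroup.LocalRing L v)).map
          (fun x => x (UnitaryGroup.PlacesOver.galInv (IsCMField.complexConj L) w))).map
          (galAdicCompletionMap (L := L) (IsCMField.complexConj L) (smul_inv_smul (IsCMField.complexConj L) w.1))) := by
    ext i j
    rfl
  have h2 : (UnitaryGroup.adelicForm L 2 (Matrix.of fun i j : Fin 2 => if i.val + j.val + 1 = 2 then (1 : L) else 0)).map
      (⇑(Pi.evalRingHom (fun w' : UnitaryGroup.PlacesOver L v => w'.1.adicCompletion L) w) ∘ ⇑(UnitaryGroup.adeleToLocal L v)) =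
      Matrix.of fun i j : Fin 2 => if i.val + j.val + 1 = 2 then (1 : w.1.adicCompletion L) else 0 := by
    rw [← Matrix.map_map, UnitaryGroup.adelicForm_map_adeleToLocal, Matrix.map_map]
    ext i j
    simp only [Matrix.map_apply, Matrix.of_apply, Function.comp_apply]
    split_ifs <;> simp
  have h3 : (a.1.val.val : Matrix (Fin 2) (Fin 2) (UnitaryGroup.LocalRing L v)).map
      ⇑(Pi.evalRingHom (fun w' : UnitaryGroup.PlacesOver L v => w'.1.adicCompletion L) w) =
      (a.1.val.val : Matrix (Fin 2) (Fin 2) (UnitaryGroup.LocalRing L v)).map (fun x => x w) := rfl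
  rw [h1, h2, h3] at hUw
  exact hUw

/-- **`σ(u_{w̄}) · u_w = 1`**: the unitarity of the `U(Φ₁)`-coordinate read at `w`. [cite: Rogawski1990, §4.9 p. 54] -/
theorem galAdicCompletionMap_finGammaTwo_galInv_mul :
    galAdicCompletionMap (L := L) (IsCMField.complexConj L) (smul_inv_smul (IsCMField.complexConj L) w.1)
        (finGammaTwo L v a (UnitaryGroup.PlacesOver.galInv (IsCMField.complexConj L) w)) * finGammaTwo L v a w = 1 := by
  have h := conjLocal_finGammaTwo_mul_finGammaTwo L v a
  have hw' := congrFun h w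
  rw [Pi.mul_apply, Pi.one_apply] at hw'
  exact hw'

/-- `u_w ≠ 0`. [folklore] -/
private theorem finGammaTwo_apply_ne_zero : finGammaTwo L v a w ≠ 0 :=
  ((Pi.isUnit_iff.1 (isUnit_finGammaTwo L v a)) w).ne_zero

/-- `σ(u_{w̄}) = u_w⁻¹`. [cite: Rogawski1990, §4.9 p. 54] -/
theorem galAdicCompletionMap_finGammaTwo_galInv :
    galAdicCompletionMap (L := L) (IsCMField.complexConj L) (smul_inv_smul (IsCMField.complexConj L) w.1)
        (finGammaTwo L v a (UnitaryGroup.PlacesOver.galInv (IsCMField.complexConj L) w)) = (finGammaTwo L v a w)⁻¹ :=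
  eq_inv_of_mul_eq_one_left (galAdicCompletionMap_finGammaTwo_galInv_mul L v a w)

/-- `g_w` is invertible (the image of a unit under `E_v → L_w`). [folklore] -/
private theorem isUnit_det_map_apply (w' : UnitaryGroup.PlacesOver L v) :
    IsUnit ((a.1.val.val : Matrix (Fin 2) (Fin 2) (UnitaryGroup.LocalRing L v)).map (fun x => x w')).det := by
  have h : IsUnit (a.1.val.val : Matrix (Fin 2) (Fin 2) (UnitaryGroup.LocalRing L v)).det := Matrix.isUnits_det_units _
  have h2 := h.map (Pi.evalRingHom (fun w'' : UnitaryGroup.PlacesOver L v => w''.1.adicCompletion L) w')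
  rw [RingHom.map_det] at h2
  exact h2

/-- **`charpoly σ(g_{w̄}) = charpoly g_w⁻¹`**: `σ(g_{w̄})ᵀ = Φ₂ g_w⁻¹ Φ₂⁻¹` by unitarity, and the characteristic polynomial is invariant under transpose and
conjugation. [cite: Rogawski1990, §4.9 pp. 54–55] -/
theorem charpoly_map_galInv_eq_charpoly_inv :
    (((a.1.val.val : Matrix (Fin 2) (Fin 2) (UnitaryGroup.LocalRing L v)).map
          (fun x => x (UnitaryGroup.PlacesOver.galInv (IsCMField.complexConj L) w))).map
          (galAdicCompletionMap (L := L) (IsCMField.complexConj L) (smul_inv_smul (IsCMField.complexConj L) w.1))).charpoly =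
      (((a.1.val.val : Matrix (Fin 2) (Fin 2) (UnitaryGroup.LocalRing L v)).map (fun x => x w))⁻¹).charpoly := by
  set X := (((a.1.val.val : Matrix (Fin 2) (Fin 2) (UnitaryGroup.LocalRing L v)).map
      (fun x => x (UnitaryGroup.PlacesOver.galInv (IsCMField.complexConj L) w))).map
      (galAdicCompletionMap (L := L) (IsCMField.complexConj L) (smul_inv_smul (IsCMField.complexConj L) w.1))) with hX
  set gw := (a.1.val.val : Matrix (Fin 2) (Fin 2) (UnitaryGroup.LocalRing L v)).map (fun x => x w) with hgw
  set A : Matrix (Fin 2) (Fin 2) (w.1.adicCompletion L) :=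
    (Matrix.of fun i j : Fin 2 => if i.val + j.val + 1 = 2 then (1 : w.1.adicCompletion L) else 0) with hA
  have hAA : A * A = 1 := by
    ext i j
    fin_cases i <;> fin_cases j <;> simp [hA, Matrix.mul_apply, Fin.sum_univ_two]
  have hU : Xᵀ * A * gw = A := transpose_map_galInv_mul_form_mul_eq L v a w
  have hgwU : IsUnit gw.det := isUnit_det_map_apply L v a w
  have hginv : gw * gw⁻¹ = 1 := Matrix.mul_nonsing_inv gw hgwU
  -- `Xᵀ = A * gw⁻¹ * A`
  have hXt : Xᵀ = A * (gw⁻¹ * A) := by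
    calc Xᵀ = Xᵀ * (A * gw * (gw⁻¹ * A)) := by
          rw [Matrix.mul_assoc A, ← Matrix.mul_assoc gw, hginv, Matrix.one_mul, hAA, Matrix.mul_one]
      _ = Xᵀ * A * gw * (gw⁻¹ * A) := by simp only [Matrix.mul_assoc]
      _ = A * (gw⁻¹ * A) := by rw [hU]
  rw [← Matrix.charpoly_transpose X, hXt, Matrix.charpoly_mul_comm, Matrix.mul_assoc, hAA, Matrix.mul_one]

/-- **THE SPLIT-PLACE IDENTITY `σ(χ_g(u)_{w̄}) = χ_{g_w}(u_w) · (det g_w)⁻¹ · u_w⁻²`** for `γ_H = (g, u) ∈ H_v` at a place `v` split in `L` (unitarity at `w` +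
the `2×2` identity `χ_{g⁻¹}(u⁻¹) = χ_g(u)(det g)⁻¹u⁻²`). [cite: Rogawski1990, §4.9 p. 55; Lemma 4.13.1 p. 70] -/
theorem galAdicCompletionMap_eval_finCharpolyTwo_galInv :
    galAdicCompletionMap (L := L) (IsCMField.complexConj L) (smul_inv_smul (IsCMField.complexConj L) w.1)
        (((finCharpolyTwo L v a).eval (finGammaTwo L v a)) (UnitaryGroup.PlacesOver.galInv (IsCMField.complexConj L) w)) =
      ((finCharpolyTwo L v a).eval (finGammaTwo L v a)) w *
        (((a.1.val.val : Matrix (Fin 2) (Fin 2) (UnitaryGroup.LocalRing L v)).map (fun x => x w)).det)⁻¹ * (finGammaTwo L v a w ^ 2)⁻¹ := by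
  set σ := galAdicCompletionMap (L := L) (IsCMField.complexConj L) (smul_inv_smul (IsCMField.complexConj L) w.1) with hσ
  rw [eval_finCharpolyTwo_apply, eval_finCharpolyTwo_apply, ← Polynomial.eval₂_at_apply, ← Polynomial.eval_map, ← Matrix.charpoly_map,
    charpoly_map_galInv_eq_charpoly_inv L v a w, galAdicCompletionMap_finGammaTwo_galInv L v a w]
  exact eval_charpoly_inv_two _ (isUnit_det_map_apply L v a w) (finGammaTwo_apply_ne_zero L v a w)

/-- **`‖χ_g(u)_{w̄}‖_{w̄} = ‖χ_{g_w}(u_w)‖_w · ‖det g_w‖_w⁻¹ · ‖u_w‖_w⁻²`** (`σ` is an isometry, ★ `norm_galAdicCompletionMap`). [cite: Rogawski1990, §4.9 p. 55] -/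
theorem norm_eval_finCharpolyTwo_galInv :
    ‖((finCharpolyTwo L v a).eval (finGammaTwo L v a)) (UnitaryGroup.PlacesOver.galInv (IsCMField.complexConj L) w)‖ =
      ‖((finCharpolyTwo L v a).eval (finGammaTwo L v a)) w‖ *
        ‖((a.1.val.val : Matrix (Fin 2) (Fin 2) (UnitaryGroup.LocalRing L v)).map (fun x => x w)).det‖⁻¹ * (‖finGammaTwo L v a w‖ ^ 2)⁻¹ := by
  rw [← norm_galAdicCompletionMap (L := L) (IsCMField.complexConj L) (smul_inv_smul (IsCMField.complexConj L) w.1),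
    galAdicCompletionMap_eval_finCharpolyTwo_galInv L v a w, norm_mul, norm_mul, norm_inv, norm_inv, norm_pow]

/-! ## §3 `D_{G∕H,v}` in the `GL₂(L_w) × L_wˣ` coordinates -/

open scoped Classical in
/-- **`D_{G∕H,v}(γ_H) = ‖χ_{g_w}(u_w)‖_w · ‖det g_w‖_w^{−1∕2} · ‖u_w‖_w^{−1}` AT A SPLIT PLACE** — print's `|D_{G∕H}(γ)| = |D_G(γ)∕D_H(γ)|` on `GL₃ ⊃ GL₂ × GL₁`,
eigenvalue-free, in the coordinates of the `w`-projection `H_v ≅ GL₂(L_w) × L_wˣ` (★ `finWeylRatio = (Π_{w′∣v}‖χ_g(u)_{w′}‖)^{1∕2}` over the two places `w, w̄`).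
[cite: Rogawski1990, §4.9 p. 55; Lemma 4.13.1 p. 70] -/
theorem finWeylRatio_eq_of_split (hw : IsCMField.complexConj L • w.1 ≠ w.1) :
    finWeylRatio L v a =
      ‖((finCharpolyTwo L v a).eval (finGammaTwo L v a)) w‖ *
        (Real.sqrt ‖((a.1.val.val : Matrix (Fin 2) (Fin 2) (UnitaryGroup.LocalRing L v)).map (fun x => x w)).det‖)⁻¹ * ‖finGammaTwo L v a w‖⁻¹ := by
  have hne := UnitaryGroup.PlacesOver.galInv_ne (IsCMField.complexConj L) w hw
  unfold finWeylRatio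
  rw [univ_eq_pair_of_split L v w, Finset.prod_pair hne.symm, norm_eval_finCharpolyTwo_galInv L v a w]
  set x : ℝ := ‖((finCharpolyTwo L v a).eval (finGammaTwo L v a)) w‖ with hx
  set d : ℝ := ‖((a.1.val.val : Matrix (Fin 2) (Fin 2) (UnitaryGroup.LocalRing L v)).map (fun x => x w)).det‖ with hd
  set t : ℝ := ‖finGammaTwo L v a w‖ with ht
  have hx0 : 0 ≤ x := norm_nonneg _
  have hd0 : 0 < d := norm_pos_iff.2 (isUnit_det_map_apply L v a w).ne_zero
  have ht0 : 0 < t := norm_pos_iff.2 (finGammaTwo_apply_ne_zero L v a w)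
  have hinner : x * (x * d⁻¹ * (t ^ 2)⁻¹) = (x * (Real.sqrt d)⁻¹ * t⁻¹) ^ 2 := by
    rw [mul_pow, mul_pow, inv_pow, inv_pow, Real.sq_sqrt hd0.le]
    ring
  rw [hinner, Real.sqrt_sq]
  positivity

/-- **BOX FORM `D_{G∕H,v}(γ_H) = ‖det(1 − K)‖_w · ‖det K‖_w^{−1∕2}`, `K = u_w⁻¹·g_w`** — the matrix of `Ad(diag(g_w, u_w))` on the root box `𝔫 ≅ L_w²` (`X ↦ g X u⁻¹`),
i.e. `|D_{G∕M}(p)|^{1∕2} = ‖det(1 − K_p)‖·δ_P(p)^{−1∕2}` in the descent normal form of the two-block parabolic (F0P3a-p04 (g11), ★ `GLnTwoBlockUnipotentConjugation`).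
[cite: Rogawski1990, Lemma 4.13.1 p. 70; §4.9 p. 55] -/
theorem finWeylRatio_eq_box_of_split (hw : IsCMField.complexConj L • w.1 ≠ w.1) :
    finWeylRatio L v a =
      ‖(1 - (finGammaTwo L v a w)⁻¹ • ((a.1.val.val : Matrix (Fin 2) (Fin 2) (UnitaryGroup.LocalRing L v)).map (fun x => x w))).det‖ *
        (Real.sqrt ‖((finGammaTwo L v a w)⁻¹ • ((a.1.val.val : Matrix (Fin 2) (Fin 2) (UnitaryGroup.LocalRing L v)).map (fun x => x w))).det‖)⁻¹ := by
  have ht := finGammaTwo_apply_ne_zero L v a w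
  rw [finWeylRatio_eq_of_split L v a w hw, det_one_sub_inv_smul_two _ ht, det_inv_smul_two, ← eval_finCharpolyTwo_apply, norm_mul, norm_mul,
    norm_inv, norm_pow, Real.sqrt_mul (by positivity), Real.sqrt_inv, Real.sqrt_sq (norm_nonneg _)]
  have ht0 : 0 < ‖finGammaTwo L v a w‖ := norm_pos_iff.2 ht
  field_simp

/-- **Squared∕Jacobian-facing form: `D_{G∕H,v}² · ‖det g_w‖ · ‖u_w‖² = ‖χ_{g_w}(u_w)‖²`.** [cite: Rogawski1990, Lemma 4.13.1 p. 70] -/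
theorem finWeylRatio_sq_mul_of_split (hw : IsCMField.complexConj L • w.1 ≠ w.1) :
    finWeylRatio L v a ^ 2 * ‖((a.1.val.val : Matrix (Fin 2) (Fin 2) (UnitaryGroup.LocalRing L v)).map (fun x => x w)).det‖ *
        ‖finGammaTwo L v a w‖ ^ 2 = ‖((finCharpolyTwo L v a).eval (finGammaTwo L v a)) w‖ ^ 2 := by
  rw [finWeylRatio_eq_of_split L v a w hw]
  have hd0 : 0 < ‖((a.1.val.val : Matrix (Fin 2) (Fin 2) (UnitaryGroup.LocalRing L v)).map (fun x => x w)).det‖ :=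
    norm_pos_iff.2 (isUnit_det_map_apply L v a w).ne_zero
  have ht0 : 0 < ‖finGammaTwo L v a w‖ := norm_pos_iff.2 (finGammaTwo_apply_ne_zero L v a w)
  rw [mul_pow, mul_pow, inv_pow, inv_pow, Real.sq_sqrt hd0.le]
  field_simp

/-! ## §4 `Δ‴_v = τ_v · D_{G∕H,v}` at a split place; `μ_v = μ_w · μ_{w̄}` -/

/-- At a split place there are two places above `v`. [cite: CasselsFrohlichANT1967, Ch. VII Prop. 1.2 (ii)] -/
theorem not_subsingleton_placesOver_of_split (hw : IsCMField.complexConj L • w.1 ≠ w.1) : ¬ Subsingleton (UnitaryGroup.PlacesOver L v) := fun _ =>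
  UnitaryGroup.PlacesOver.galInv_ne (IsCMField.complexConj L) w hw (Subsingleton.elim _ _)

variable (H' : Matrix (Fin 3) (Fin 3) L)

open scoped Classical in
/-- **`Δ‴_v(γ_H, γ′) = τ_v(γ_H) · D_{G∕H,v}(γ_H)` AT A SPLIT PLACE** for every `γ′` matching `γ_H` with `χ_g(u)` a unit: the sign is `κ_v = +1` (★
`finKappaAt_of_not_subsingleton`; `P_v ≠ 0` ★ `finEigenlineProjector_ne_zero_of_isUnit`) — the factor is a function of `γ_H` alone («`+1` at the split places»).
[cite: Rogawski1990, §14.6 p. 242; §4.9 p. 55] -/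
theorem finExplicitDelta_eq_tau_mul_weyl_of_split (hw : IsCMField.complexConj L • w.1 ≠ w.1) (μ : HeckeCharacter L) {b : (UnitaryGroup.cmDatum L 3 H').Local v}
    (h : IsLocalNormPair L H' v a b) (hu : IsUnit ((finCharpolyTwo L v a).eval (finGammaTwo L v a))) :
    finExplicitDelta L v H' a μ b = finTau L v a μ * (finWeylRatio L v a : ℂ) := by
  rw [finExplicitDelta_of_isLocalNormPair L v H' a μ h,
    finKappaAt_of_not_subsingleton L v H' a (finEigenlineProjector_ne_zero_of_isUnit L v H' a b h hu) (not_subsingleton_placesOver_of_split L v w hw),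
    Int.cast_one, mul_one]

open scoped Classical in
/-- **`μ_v(x) = μ_w(x_w) · μ_{w̄}(x_{w̄})`** at a split place, for a unit `x ∈ E_v` (★ `semilocalComponent_eq_prod` over the two places `w, w̄`); applied to `x = u` and
`x = −χ_g(u)·det g⁻¹` this factors `τ_v(γ_H)`. [cite: TateThesis1967, §4.3] [cite: Rogawski1990, §4.9 p. 55] -/
theorem finHeckeValue_eq_prod_pair_of_split (hw : IsCMField.complexConj L • w.1 ≠ w.1) (μ : HeckeCharacter L) {x : UnitaryGroup.LocalRing L v} (hx : IsUnit x) :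
    finHeckeValue L v μ x =
      ((μ.localComponent w.1 (MulEquiv.piUnits hx.unit w) : ℂˣ) : ℂ) *
        ((μ.localComponent (UnitaryGroup.PlacesOver.galInv (IsCMField.complexConj L) w).1
          (MulEquiv.piUnits hx.unit (UnitaryGroup.PlacesOver.galInv (IsCMField.complexConj L) w)) : ℂˣ) : ℂ) := by
  have hne := UnitaryGroup.PlacesOver.galInv_ne (IsCMField.complexConj L) w hw
  rw [finHeckeValue_of_isUnit L v μ hx, UnitaryGroup.semilocalComponent_eq_prod, univ_eq_pair_of_split L v w,
    Finset.prod_pair hne.symm, Units.val_mul]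

end Split

end Literature.NumberTheory.Rogawski1990

end
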